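import Literature.NumberTheory.Sieve.MaynardBoundedGaps
import Literature.NumberTheory.Sieve.ElliottHalberstamBridgeProofs
import Literature.NumberTheory.Sieve.MaynardSmallK
import Literature.NumberTheory.Sieve.MaynardTaoTheoremProofs
import HarnessLib

/-!
# Maynard 2015, Theorem 1.4 (`liminf (p_{n+1} − p_n) ≤ 12` under Elliott–Halberstam) proved:
# `frequently_nth_prime_succ_le_add_of_elliottHalberstam_holds`

Topic `Literature/NumberTheory/Sieve`; sibling proof file (theorems only, no new definitions) of
`ParityWave0.lean` for the Wave-0 named fact
`Literature.NumberTheory.Sieve.frequently_nth_prime_succ_le_add_of_elliottHalberstam` (parity.S13):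
J. Maynard, *Small gaps between primes*, Ann. of Math. (2) 181 (2015), 383–413 = arXiv:1311.4600,
**Theorem 1.4** of the held arXiv text (p. 4; the Wave-0 docstring calls the same statement
"Thm 1.3"): *Assume that the primes have level of distribution `θ` for every `θ < 1`. Then
`liminf_n (p_{n+1} − p_n) ≤ 12`* (first clause) — vendored as
`ElliottHalberstamConjecture → ∃ᶠ n, p_{n+1} ≤ p_n + 12` (equivalent for integer gaps; the
hypothesis is the Wave-0 form `∀ θ < 1, EH θ` of the Elliott–Halberstam conjecture, parity.S25).

The printed proof (§4, p. 8 of the arXiv text: "Next we take `k = 5` and `H = {0, 2, 6, 8, 12}`,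
with `θ = 1 − ε` again. By Proposition 4.3 we have `M_5 > 2`, and so `θ M_5 / 2 > 1` for `ε`
sufficiently small. Thus, by Proposition 4.2, `liminf_n (p_{n+1} − p_n) ≤ 12` under the
Elliott–Halberstam conjecture.") is already assembled in the tree as the conditional theorem
`Literature.NumberTheory.Sieve.frequently_nth_prime_succ_le_add_of_elliottHalberstam_of`
(`MaynardBoundedGaps.lean`: the admissible 5-tuple `{0, 2, 6, 8, 12}` of diameter `12`, a level
`2/M < θ < 1`, Prop. 4.2 with `m = 1`, `k = 5`, and the passage to consecutive primes), from three
named facts, each of which has since been DISCHARGED in the tree: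

* `Literature.NumberTheory.Sieve.elliottHalberstam_iff_wave0` (the bridge between the
  level-of-distribution form `LevelOfDistribution.ElliottHalberstam = ∀ θ < 1, PrimesHaveLevel θ`
  consumed by Prop. 4.2 and the Wave-0 form `ElliottHalberstamConjecture = ∀ θ < 1, EH θ`):
  `Literature.NumberTheory.Sieve.elliottHalberstam_iff_wave0_holds`
  (`ElliottHalberstamBridgeProofs.lean`; Iwaniec–Kowalski §17.1);
* `Literature.NumberTheory.Sieve.frequently_card_primes_ge_of_maynardFunctional` (Maynard's
  Prop. 4.2, p. 7, for square-integrable admissible `F`):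
  `Literature.NumberTheory.Sieve.frequently_card_primes_ge_of_maynardFunctional_holds`
  (`MaynardTaoTheoremProofs.lean`: Prop. 4.1 = Lemmas 5.1–6.3 — `maynard_S1_asymptotic_holds`,
  `maynard_S2_asymptotic_holds` — the positivity argument of §4 for `C¹ · 1_{R_k}` test functions,
  and the `L²` reduction of `MaynardTaoL2Reduction.lean`);
* `Literature.NumberTheory.Sieve.exists_two_lt_maynardFunctional_five` (Maynard's Prop. 4.3 (ii),
  p. 7, proved in §7, p. 16: `M_5 ≥ 1417255/708216 > 2` for
  `P = (1 − P₁)P₂ + (7/10)(1 − P₁)² + (1/14)P₂ − (3/14)(1 − P₁)`):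
  `Literature.NumberTheory.Sieve.exists_two_lt_maynardFunctional_five_holds` (`MaynardSmallK.lean`,
  exact Dirichlet integrals over the simplex `R₅`).

This leaf file (it imports the ends of the three developments, which none of them does) applies the
deduction to the three discharges. All axioms standard; no named fact remains on this path. The
second clause of Theorem 1.4 (`liminf_n (p_{n+2} − p_n) ≤ 600` under EH) is not vendored in Wave 0
and is not treated here.

## References

* J. Maynard, *Small gaps between primes*, Ann. of Math. (2) 181 (2015), 383–413,
  doi:10.4007/annals.2015.181.1.7 = arXiv:1311.4600; Theorem 1.4 (p. 4 of the arXiv text),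
  Propositions 4.2, 4.3 (p. 7) and the proof of Theorem 1.4 in §4 (p. 8). [MaynardAnnals2015]
* H. Iwaniec, E. Kowalski, *Analytic Number Theory*, AMS Colloquium Publ. 53 (2004), §17.1
  (equivalent forms of the level of distribution). [IwaniecKowalski2004]
-/

namespace Literature.NumberTheory.Sieve

/-- **Maynard 2015, Theorem 1.4 (first clause), PROVED**: under the Elliott–Halberstam conjecture
(Wave-0 form `ElliottHalberstamConjecture = ∀ θ < 1, EH θ`, parity.S25),
`liminf_n (p_{n+1} − p_n) ≤ 12`, i.e. the Wave-0 named fact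
`frequently_nth_prime_succ_le_add_of_elliottHalberstam` (`EH ⇒ ∃ᶠ n, p_{n+1} ≤ p_n + 12`)
DISCHARGED along the printed proof (§4, p. 8 of arXiv:1311.4600: `k = 5`, `H = {0, 2, 6, 8, 12}`,
`θ = 1 − ε`, `M_5 > 2` by Prop. 4.3, then Prop. 4.2): the tree's deduction
`frequently_nth_prime_succ_le_add_of_elliottHalberstam_of` fed with the three discharged inputs
`elliottHalberstam_iff_wave0_holds` (bridge between the two vendored forms of EH),
`frequently_card_primes_ge_of_maynardFunctional_holds` (Prop. 4.2) and
`exists_two_lt_maynardFunctional_five_holds` (Prop. 4.3 (ii), `M_5 > 2`).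
[cite: MaynardAnnals2015, Theorem 1.4 (arXiv numbering; p. 4) and its proof in §4 (p. 8)] -/
theorem frequently_nth_prime_succ_le_add_of_elliottHalberstam_holds :
    frequently_nth_prime_succ_le_add_of_elliottHalberstam :=
  frequently_nth_prime_succ_le_add_of_elliottHalberstam_of elliottHalberstam_iff_wave0_holds
    frequently_card_primes_ge_of_maynardFunctional_holds exists_two_lt_maynardFunctional_five_holds

end Literature.NumberTheory.Sieve
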